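import Summits.QuantumFields.BalabanUV.T4Continuum.Support.NE7SliceTangentPartLimitNLR
import HarnessLib

/-!
# NE7SliceLimitNLR — RADIUS-PARAMETRISED RE-ISSUE of `NE7SliceLimitNL` (`hLP` on a displayed sup-radius `b₀` of the chart fields, plus the orbit bound `sup‖X(u j)‖ ≤ b₀`, the limit's bound derived by `tendsto_repLog`; dischargeable from t4-ne7-p1 g103's (LP) with `KP := 24·C_Γ·M²·b₀`); THE CONTINUITY HALF FOR THE (S1) ITERATION ON THE NONLINEAR FRAME TARGET, ONE-CALL SHAPE ((R1′), named ask [NE7P1-G103-ASK-4], companion of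
# `NE7SliceTangentPartLimitNLR`): from exactly the data the re-issued `slice_orbit` delivers — per-`j` working-region facts, a unitary `(tower)`-periodic SITEWISE limit `u⋆`, a geometric rate
# `‖u j y − u⋆ y‖ ≤ C·ϑ^j`, `D̃f(u j) ≤ ϑ^j·δ₀` — plus the road's (LP) letter (`hLP` on the radius `b₀`, free `KP ≥ 0`), the orbit bound `sup‖X(u j)‖ ≤ b₀` and NL state facts LEMMA-SHAPED (`hskewNL`: `φ̃` skew on the working region; `hsplitNL`: the
# normalised split of `(T̃, h̃)` exists there; `hperNL`: the `m̃`-integrand is `N`-periodic there): `T̃(u⋆) ∈ 𝒯_E(W)`, `framePotW T̃(u⋆) = h̃(u⋆)`,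
# `mlog v_{k+1}(X(u⋆)) = h(u⋆) + framePotW Ñ(u⋆)` ((1.37) up to the N-frame) and `m̃(u⋆) = 0`

Cell `pub-balaban`, rung (B)+1 sub-cell t4, lineage `b2b-balaban-t4-ne7b-p1`, generation 151 (OWNER of BINDER row NE7b; junction service for the NE crew, ruling R-OWNER-149-1 (2)).
The chart∕corner facts at `u⋆` come from gen 150's `NE7SliceLimitWorkingRegion.workingRegion_of_limit`; the rest is `NE7SliceTangentPartLimitNLR` §3 with `r j := C·ϑ^j`.
WHAT ([folklore]; 0 def, 0 sorry).  **`limitNLR_of_geometric`** (the four conclusions as a conjunction, binders = the re-issued `slice_orbit`'s outputs + `hLP`, `hskewNL`, `hsplitNL`, `hperNL`).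
HONEST FRAMING (page 1): bookkeeping by name; the displayed hypotheses are the road's (LP) and NL state facts, asserted for nothing here; NOT the re-issued (S1) engine, NOT (S2), NOT NE7, nothing of
row NE7b; spine 0∕9; finite T⁴ rung (B)+1 — NOT infinite volume, NOT mass gap, NOT BetaPertH, NOT Clay.  Continuum YM on T⁴ ⇐ BetaPertH ∧ nine spine estimates (0/9 proved); BetaPertH ⇐ (D1) ∧
(D4) ∧ CAP+tail; G-an2-4 gates asym, D1 and NE2/3/4.
-/

set_option autoImplicit false

open scoped BigOperators Matrix.Norms.L2Operator Topology
open NormedSpace Finset Filter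

namespace Summit.QuantumFields.BalabanUV.T4Continuum.NE7SliceLimitNLR

open Literature.MathematicalPhysics.QuantumFieldTheory.Balaban1983to89
open B7Prop1Explicit B7Prop2Explicit MatrixLog
open B7Eq92Concrete (vcov)
open T4AveragingDeficitWall (IsUnitaryCfg IsSkewDir SmallField vary)
open T4AveragingDeficitWallBoundary (IsPeriodicCfg)
open AveragingDeficitPeriodicCounting (IsPeriodicDir)
open AveragingDeficitMultiLevelPrep (cavgIter LevelSmall tower)
open BlockAveragePushDirGauge (gaugeDir isPeriodicDir_gaugeDir)
open NE3EnergyShapes (IsUnitarySite IsPeriodicSite)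
open NE3TangentCovariantTower (framePotW)
open NE3QbarIterCovLiftPrep (cruxC)
open NE3SmoothRightInverseW (rightInvW)
open NE3LinearisedAverageSup (curvSum levelData)
open NE3RightInverseSupLetters (norm_rightInvW_le norm_gaugeDir_le_two_mul supC)
open NE3.PairLandauB8Avg (relPert)
open NE7MeanZeroGaugeSliceW (energyBlockLandauW)
open NE7RightInverseLinear (rightInvW_sub)
open NE7EnergySliceClosed (mem_energyBlockLandauW_of_tendsto)
open NE7SliceIterationState (repLog cornerLog coarseDatum IsNormalisedSplit siteSup_le siteSup_nonneg le_siteSup bondSup le_bondSup bondSup_nonneg)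
open NE7SliceIterationStateNL
open NE7SliceTangentPartLimit (norm_repLog_sub_le_sup norm_cornerLog_sub_le norm_coarseDatum_sub_le)
open NE7SliceFrameMatchingLimit (framePotW_sub norm_framePotW_sub_le lipT_nonneg)
open NE7SliceLimitWorkingRegion (workingRegion_of_limit)
open NE7SliceTangentPartLimitNLR (limitNLR_of_rate)
open NE7SliceLimitWorkingRegion (tendsto_repLog)

noncomputable section

variable {d : ℕ} {n : Type*} [Fintype n] [DecidableEq n] [Nonempty n]

/-! ## §4 The limit — one-call geometric shape, NL facts lemma-shaped -/

section Geometric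

variable {L : ℕ} (hL : 2 ≤ L) (k : ℕ) {W : Site d → Fin d → (Matrix n n ℂ)ˣ} {x : ℝ} (hWu : IsUnitaryCfg W) (hx : 0 ≤ x) (hs : LevelSmall d L k x)
  (hWx : SmallField W x) (N : ℕ) [NeZero N] (hθ : cruxC d L * (((L : ℝ) ^ (k + 1)) ^ 2 * x) < 1) (U' : Site d → Fin d → (Matrix n n ℂ)ˣ)
  (hWP : IsPeriodicCfg W ((tower L N (k + 1) : ℕ) : ℤ)) (hU'u : IsUnitaryCfg U') (hU'P : IsPeriodicCfg U' ((tower L N (k + 1) : ℕ) : ℤ))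
  (hε : ((L : ℝ) ^ (k + 1)) ^ 2 * x ≤ 1) (hA : curvSum d L (k + 1) x ≤ 2 / 3 * L)
  {b₀ KP : ℝ} (hKP : 0 ≤ KP)
  (hLP : ∀ (X X' : Site d → Fin d → Matrix n n ℂ) (bX : ℝ), (∀ y κ, ‖X y κ‖ ≤ b₀) → (∀ y κ, ‖X' y κ‖ ≤ b₀) → 0 ≤ bX →
    (∀ y κ, ‖X y κ - X' y κ‖ ≤ bX) → ∀ z : Site d,
      ‖(mlog ((vcov L W (relPert W X) (k + 1) z : (Matrix n n ℂ)ˣ) : Matrix n n ℂ) - framePotW L (k + 1) W X z)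
          - (mlog ((vcov L W (relPert W X') (k + 1) z : (Matrix n n ℂ)ˣ) : Matrix n n ℂ) - framePotW L (k + 1) W X' z)‖ ≤ KP * bX)
  -- the road's NL state facts, lemma-shaped: on the working region `φ̃` is skew, the normalised split exists, the `m̃`-integrand is `N`-periodic
  (hskewNL : ∀ w : Site d → (Matrix n n ℂ)ˣ, IsUnitarySite w → IsPeriodicSite w ((tower L N (k + 1) : ℕ) : ℤ) → gaugeAct w U' = vary W (repLog W U' w) 1 →
    (∀ y κ, ‖repLog W U' w y κ‖ ≤ 1 / 8) → (∀ z, ((w (((L : ℤ) ^ (k + 1)) • z) : (Matrix n n ℂ)ˣ) : Matrix n n ℂ) = exp (cornerLog L k w z)) →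
    (∀ z, ‖cornerLog L k w z‖ ≤ 1 / 8) → IsSkewDir (coarseDatumNL L k W U' w))
  (hsplitNL : ∀ w : Site d → (Matrix n n ℂ)ˣ, IsUnitarySite w → IsPeriodicSite w ((tower L N (k + 1) : ℕ) : ℤ) → gaugeAct w U' = vary W (repLog W U' w) 1 →
    (∀ y κ, ‖repLog W U' w y κ‖ ≤ 1 / 8) → (∀ z, ((w (((L : ℤ) ^ (k + 1)) • z) : (Matrix n n ℂ)ˣ) : Matrix n n ℂ) = exp (cornerLog L k w z)) →
    (∀ z, ‖cornerLog L k w z‖ ≤ 1 / 8) → ∃ p : (Site d → Matrix n n ℂ) × (Site d → Fin d → Matrix n n ℂ),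
      IsNormalisedSplit L k N W (tangentPartNL hL k hWu hx hs hWx N hθ U' w) (effCornerLog L k W U' w) p.1 p.2)
  (hperNL : ∀ w : Site d → (Matrix n n ℂ)ˣ, IsUnitarySite w → IsPeriodicSite w ((tower L N (k + 1) : ℕ) : ℤ) → gaugeAct w U' = vary W (repLog W U' w) 1 →
    (∀ y κ, ‖repLog W U' w y κ‖ ≤ 1 / 8) → (∀ z, ((w (((L : ℤ) ^ (k + 1)) • z) : (Matrix n n ℂ)ˣ) : Matrix n n ℂ) = exp (cornerLog L k w z)) →
    (∀ z, ‖cornerLog L k w z‖ ≤ 1 / 8) → ∀ (z : Site d) (i : Fin d),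
      framePotW L (k + 1) W (tangentPartNL hL k hWu hx hs hWx N hθ U' w) (z + (N : ℤ) • e i) - effCornerLog L k W U' w (z + (N : ℤ) • e i)
        = framePotW L (k + 1) W (tangentPartNL hL k hWu hx hs hWx N hθ U' w) z - effCornerLog L k W U' w z)
  (u : ℕ → Site d → (Matrix n n ℂ)ˣ) (ulim : Site d → (Matrix n n ℂ)ˣ)
  (hu : ∀ j, IsUnitarySite (u j)) (huP : ∀ j, IsPeriodicSite (u j) ((tower L N (k + 1) : ℕ) : ℤ))
  (hgu : ∀ j, gaugeAct (u j) U' = vary W (repLog W U' (u j)) 1) (hXu : ∀ j y κ, ‖repLog W U' (u j) y κ‖ ≤ 1 / 8) (hXbj : ∀ j y κ, ‖repLog W U' (u j) y κ‖ ≤ b₀)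
  (hcu : ∀ j z, (((u j) (((L : ℤ) ^ (k + 1)) • z) : (Matrix n n ℂ)ˣ) : Matrix n n ℂ) = exp (cornerLog L k (u j) z)) (hhu : ∀ j z, ‖cornerLog L k (u j) z‖ ≤ 1 / 8)
  (hl : IsUnitarySite ulim) (hlP : IsPeriodicSite ulim ((tower L N (k + 1) : ℕ) : ℤ))
  (hconv : ∀ y, Tendsto (fun j => (((u j) y : (Matrix n n ℂ)ˣ) : Matrix n n ℂ)) atTop (𝓝 ((ulim y : (Matrix n n ℂ)ˣ) : Matrix n n ℂ)))
  {C ϑ δ₀ : ℝ} (hϑ0 : 0 ≤ ϑ) (hϑ1 : ϑ < 1)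
  (hrate : ∀ j y, ‖(((u j) y : (Matrix n n ℂ)ˣ) : Matrix n n ℂ) - (ulim y : (Matrix n n ℂ)ˣ)‖ ≤ C * ϑ ^ j)
  (hDf : ∀ j, sliceDefectNL hL k hWu hx hs hWx N hθ U' (u j) ≤ ϑ ^ j * δ₀)

include hWP hU'u hU'P hε hA hKP hLP hskewNL hsplitNL hperNL hu huP hgu hXu hXbj hcu hhu hl hlP hconv hϑ0 hϑ1 hrate hDf in
/-- **THE (R1′) LIMIT IN ONE CALL** from the data the re-issued `slice_orbit` delivers (per-`j` working-region facts incl. the orbit bound `sup‖X(u j)‖ ≤ b₀`, unitary `(tower)`-periodic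
sitewise limit `u⋆`, geometric rate `C·ϑ^j`, `D̃f(u j) ≤ ϑ^j·δ₀`) plus the road's (LP) on the radius `b₀` (`hLP`, `KP ≥ 0`) and NL state facts lemma-shaped (`hskewNL`, `hsplitNL`, `hperNL`):
(chart at `u⋆` ∧ `sup‖X(u⋆)‖ ≤ b₀` ∧ corners at `u⋆`) ∧ `T̃(u⋆) ∈ 𝒯_E(W)` ∧ `framePotW T̃(u⋆) = h̃(u⋆)` ∧ `mlog v_{k+1}(X(u⋆)) = h(u⋆) + framePotW Ñ(u⋆)` ∧ `m̃(u⋆) = 0` ∧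
trivial split at `u⋆` ∧ `D̃f(u⋆) = 0` — the limit's working-region facts are returned too (the road's downstream `hDL′` binder needs them).
The chart∕corner facts and the bound `sup‖X(u⋆)‖ ≤ b₀` at `u⋆` come from `NE7SliceLimitWorkingRegion` (`workingRegion_of_limit`, `tendsto_repLog`). [folklore] -/
theorem limitNLR_of_geometric :
    (gaugeAct ulim U' = vary W (repLog W U' ulim) 1 ∧ (∀ y κ, ‖repLog W U' ulim y κ‖ ≤ b₀) ∧
        (∀ z, ((ulim (((L : ℤ) ^ (k + 1)) • z) : (Matrix n n ℂ)ˣ) : Matrix n n ℂ) = exp (cornerLog L k ulim z))) ∧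
      tangentPartNL hL k hWu hx hs hWx N hθ U' ulim ∈ energyBlockLandauW (d := d) (n := n) L N (k + 1) W ∧
      framePotW L (k + 1) W (tangentPartNL hL k hWu hx hs hWx N hθ U' ulim) = effCornerLog L k W U' ulim ∧
      (∀ z, mlog ((vcov L W (relPert W (repLog W U' ulim)) (k + 1) z : (Matrix n n ℂ)ˣ) : Matrix n n ℂ)
        = cornerLog L k ulim z + framePotW L (k + 1) W (normalPartNL hL k hWu hx hs hWx N hθ U' ulim) z) ∧
      frameMismatchNL hL k hWu hx hs hWx N hθ U' ulim = 0 ∧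
      ((∀ y μ, slicePartNL hL k hWu hx hs hWx N hθ U' ulim y μ = tangentPartNL hL k hWu hx hs hWx N hθ U' ulim y μ) ∧
        ∀ y μ, gaugeDir W (gaugeFunNL hL k hWu hx hs hWx N hθ U' ulim) y μ = 0) ∧
      sliceDefectNL hL k hWu hx hs hWx N hθ U' ulim = 0 := by
  obtain ⟨hgl, hXl, hcl, hhl⟩ := workingRegion_of_limit k hWu hU'u hu hl hconv hgu hXu hcu hhu
  have hXbl : ∀ y κ, ‖repLog W U' ulim y κ‖ ≤ b₀ := fun y κ =>
    le_of_tendsto' (tendsto_repLog hWu hU'u hu hl hconv hgu hXu y κ).norm fun j => hXbj j y κ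
  have hpow : Tendsto (fun j => ϑ ^ j) atTop (𝓝 0) := tendsto_pow_atTop_nhds_zero_of_lt_one hϑ0 hϑ1
  have hr : Tendsto (fun j => C * ϑ ^ j) atTop (𝓝 0) := by simpa using hpow.const_mul C
  have hDf0 : Tendsto (fun j => sliceDefectNL hL k hWu hx hs hWx N hθ U' (u j)) atTop (𝓝 0) := by
    have hup : Tendsto (fun j => ϑ ^ j * δ₀) atTop (𝓝 0) := by simpa using hpow.mul_const δ₀
    exact squeeze_zero (fun j => sliceDefectNL_nonneg hL k hWu hx hs hWx N hθ U' (u j)) hDf hup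
  have hφj : ∀ j, IsSkewDir (coarseDatumNL L k W U' (u j)) := fun j => hskewNL (u j) (hu j) (huP j) (hgu j) (hXu j) (hcu j) (hhu j)
  have hφl : IsSkewDir (coarseDatumNL L k W U' ulim) := hskewNL ulim hl hlP hgl hXl hcl hhl
  have hexj := fun j => hsplitNL (u j) (hu j) (huP j) (hgu j) (hXu j) (hcu j) (hhu j)
  have hexl := hsplitNL ulim hl hlP hgl hXl hcl hhl
  have hperj := fun j => hperNL (u j) (hu j) (huP j) (hgu j) (hXu j) (hcu j) (hhu j)
  exact ⟨⟨hgl, hXbl, hcl⟩, limitNLR_of_rate hL k hWu hx hs hWx N hθ U' hWP hU'u hU'P hε hA hKP hLP u ulim hu huP hgu hXu hXbj hcu hhu hl hlP hgl hXl hXbl hcl hhl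
    hφj hφl hexj hperj (fun j => C * ϑ ^ j) hrate hr hDf0 hexl⟩

end Geometric

end

end Summit.QuantumFields.BalabanUV.T4Continuum.NE7SliceLimitNLR

/-! ## §5 (v2 APPEND, gen 152; named ask [NE7P1-G103-ASK-5b]) The limit in one call — NL facts lemma-shaped ON THE REGIME-SIZED working region, plus the limit's size inheritance

t4-ne7-p1 g103's suppliers of the three NL state facts (`NE7SliceIterationStateFactsNL.coarseDatumNL_skew_periodic` ∕ `splitNL_exists` ∕ `frameNL_periodic`) need, besides the six
1∕8-facts of the working region, the (−1)-size bound `∀ y κ, ‖repLog W U′ w y κ‖ ≤ b₀` of the chart field (skewness of the frame defect `P(w) = mlog v_{k+1}(X(w)) − framePotW X(w)` rests on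
the unitarity of `v_{k+1}` via [B8] Prop 7's tower and on (163), both in B7's Prop-4 regime `2048·d·M·b₀ ≤ 1`; on the bare 1∕8-ball the series `mlog` can leave its disc at high levels).
`limitNLR_of_geometric_reg` is `limitNLR_of_geometric` with that SEVENTH antecedent added to `hskewNL` ∕ `hsplitNL` ∕ `hperNL` — fed at `u j` by the displayed orbit bound `hXbj` and at
`u⋆` by the derived limit bound — and with the conclusion extended by the limit's SIZE INHERITANCE (displayed per-`j` bounds `‖X(u j)‖ ≤ sX`, `‖h(u j)‖ ≤ sh` pass to `u⋆` by
`tendsto_repLog` ∕ `tendsto_cornerLog`), which the road's `NE7SliceTheoremNL` lists (`M‖X⋆‖ ≤ S`, `‖h⋆‖ ≤ S`: take `sX := S∕M`, `sh := S`).  `limitNLR_of_rate` is untouched (it takes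
the per-`j` ∕ limit facts `hφj hφl hexj hexl hperj`, not ∀w-binders).  [folklore]; 0 def, 0 sorry; nothing of Bałaban's asserted; NOT the (S1)-NL assembly, NOT (S2), NOT NE7, nothing of
row NE7b; spine 0∕9. -/

namespace Summit.QuantumFields.BalabanUV.T4Continuum.NE7SliceLimitNLR

open Literature.MathematicalPhysics.QuantumFieldTheory.Balaban1983to89
open B7Prop1Explicit B7Prop2Explicit MatrixLog
open B7Eq92Concrete (vcov)
open T4AveragingDeficitWall (IsUnitaryCfg IsSkewDir SmallField vary)
open T4AveragingDeficitWallBoundary (IsPeriodicCfg)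
open AveragingDeficitPeriodicCounting (IsPeriodicDir)
open AveragingDeficitMultiLevelPrep (cavgIter LevelSmall tower)
open BlockAveragePushDirGauge (gaugeDir isPeriodicDir_gaugeDir)
open NE3EnergyShapes (IsUnitarySite IsPeriodicSite)
open NE3TangentCovariantTower (framePotW)
open NE3QbarIterCovLiftPrep (cruxC)
open NE3SmoothRightInverseW (rightInvW)
open NE3LinearisedAverageSup (curvSum levelData)
open NE3.PairLandauB8Avg (relPert)
open NE7MeanZeroGaugeSliceW (energyBlockLandauW)
open NE7EnergySliceClosed (mem_energyBlockLandauW_of_tendsto)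
open NE7SliceIterationState (repLog cornerLog coarseDatum IsNormalisedSplit)
open NE7SliceIterationStateNL
open NE7SliceLimitWorkingRegion (workingRegion_of_limit tendsto_repLog tendsto_cornerLog)
open NE7SliceTangentPartLimitNLR (limitNLR_of_rate)

noncomputable section

variable {d : ℕ} {n : Type*} [Fintype n] [DecidableEq n] [Nonempty n]

section GeometricReg

variable {L : ℕ} (hL : 2 ≤ L) (k : ℕ) {W : Site d → Fin d → (Matrix n n ℂ)ˣ} {x : ℝ} (hWu : IsUnitaryCfg W) (hx : 0 ≤ x) (hs : LevelSmall d L k x)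
  (hWx : SmallField W x) (N : ℕ) [NeZero N] (hθ : cruxC d L * (((L : ℝ) ^ (k + 1)) ^ 2 * x) < 1) (U' : Site d → Fin d → (Matrix n n ℂ)ˣ)
  (hWP : IsPeriodicCfg W ((tower L N (k + 1) : ℕ) : ℤ)) (hU'u : IsUnitaryCfg U') (hU'P : IsPeriodicCfg U' ((tower L N (k + 1) : ℕ) : ℤ))
  (hε : ((L : ℝ) ^ (k + 1)) ^ 2 * x ≤ 1) (hA : curvSum d L (k + 1) x ≤ 2 / 3 * L)
  {b₀ KP : ℝ} (hKP : 0 ≤ KP)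
  (hLP : ∀ (X X' : Site d → Fin d → Matrix n n ℂ) (bX : ℝ), (∀ y κ, ‖X y κ‖ ≤ b₀) → (∀ y κ, ‖X' y κ‖ ≤ b₀) → 0 ≤ bX →
    (∀ y κ, ‖X y κ - X' y κ‖ ≤ bX) → ∀ z : Site d,
      ‖(mlog ((vcov L W (relPert W X) (k + 1) z : (Matrix n n ℂ)ˣ) : Matrix n n ℂ) - framePotW L (k + 1) W X z)
          - (mlog ((vcov L W (relPert W X') (k + 1) z : (Matrix n n ℂ)ˣ) : Matrix n n ℂ) - framePotW L (k + 1) W X' z)‖ ≤ KP * bX)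
  -- the road's NL state facts, lemma-shaped ON THE REGIME-SIZED working region: the six 1∕8-facts AND the (−1)-size bound `sup‖X(w)‖ ≤ b₀` (seventh antecedent)
  (hskewNL : ∀ w : Site d → (Matrix n n ℂ)ˣ, IsUnitarySite w → IsPeriodicSite w ((tower L N (k + 1) : ℕ) : ℤ) → gaugeAct w U' = vary W (repLog W U' w) 1 →
    (∀ y κ, ‖repLog W U' w y κ‖ ≤ 1 / 8) → (∀ z, ((w (((L : ℤ) ^ (k + 1)) • z) : (Matrix n n ℂ)ˣ) : Matrix n n ℂ) = exp (cornerLog L k w z)) →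
    (∀ z, ‖cornerLog L k w z‖ ≤ 1 / 8) → (∀ y κ, ‖repLog W U' w y κ‖ ≤ b₀) → IsSkewDir (coarseDatumNL L k W U' w))
  (hsplitNL : ∀ w : Site d → (Matrix n n ℂ)ˣ, IsUnitarySite w → IsPeriodicSite w ((tower L N (k + 1) : ℕ) : ℤ) → gaugeAct w U' = vary W (repLog W U' w) 1 →
    (∀ y κ, ‖repLog W U' w y κ‖ ≤ 1 / 8) → (∀ z, ((w (((L : ℤ) ^ (k + 1)) • z) : (Matrix n n ℂ)ˣ) : Matrix n n ℂ) = exp (cornerLog L k w z)) →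
    (∀ z, ‖cornerLog L k w z‖ ≤ 1 / 8) → (∀ y κ, ‖repLog W U' w y κ‖ ≤ b₀) → ∃ p : (Site d → Matrix n n ℂ) × (Site d → Fin d → Matrix n n ℂ),
      IsNormalisedSplit L k N W (tangentPartNL hL k hWu hx hs hWx N hθ U' w) (effCornerLog L k W U' w) p.1 p.2)
  (hperNL : ∀ w : Site d → (Matrix n n ℂ)ˣ, IsUnitarySite w → IsPeriodicSite w ((tower L N (k + 1) : ℕ) : ℤ) → gaugeAct w U' = vary W (repLog W U' w) 1 →
    (∀ y κ, ‖repLog W U' w y κ‖ ≤ 1 / 8) → (∀ z, ((w (((L : ℤ) ^ (k + 1)) • z) : (Matrix n n ℂ)ˣ) : Matrix n n ℂ) = exp (cornerLog L k w z)) →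
    (∀ z, ‖cornerLog L k w z‖ ≤ 1 / 8) → (∀ y κ, ‖repLog W U' w y κ‖ ≤ b₀) → ∀ (z : Site d) (i : Fin d),
      framePotW L (k + 1) W (tangentPartNL hL k hWu hx hs hWx N hθ U' w) (z + (N : ℤ) • e i) - effCornerLog L k W U' w (z + (N : ℤ) • e i)
        = framePotW L (k + 1) W (tangentPartNL hL k hWu hx hs hWx N hθ U' w) z - effCornerLog L k W U' w z)
  (u : ℕ → Site d → (Matrix n n ℂ)ˣ) (ulim : Site d → (Matrix n n ℂ)ˣ)
  (hu : ∀ j, IsUnitarySite (u j)) (huP : ∀ j, IsPeriodicSite (u j) ((tower L N (k + 1) : ℕ) : ℤ))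
  (hgu : ∀ j, gaugeAct (u j) U' = vary W (repLog W U' (u j)) 1) (hXu : ∀ j y κ, ‖repLog W U' (u j) y κ‖ ≤ 1 / 8) (hXbj : ∀ j y κ, ‖repLog W U' (u j) y κ‖ ≤ b₀)
  (hcu : ∀ j z, (((u j) (((L : ℤ) ^ (k + 1)) • z) : (Matrix n n ℂ)ˣ) : Matrix n n ℂ) = exp (cornerLog L k (u j) z)) (hhu : ∀ j z, ‖cornerLog L k (u j) z‖ ≤ 1 / 8)
  -- the orbit's sizes, inherited by the limit (free reals; the road's weighted orbit gives `sX := S∕M`, `sh := S`)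
  {sX sh : ℝ} (hXsj : ∀ j y κ, ‖repLog W U' (u j) y κ‖ ≤ sX) (hhsj : ∀ j z, ‖cornerLog L k (u j) z‖ ≤ sh)
  (hl : IsUnitarySite ulim) (hlP : IsPeriodicSite ulim ((tower L N (k + 1) : ℕ) : ℤ))
  (hconv : ∀ y, Tendsto (fun j => (((u j) y : (Matrix n n ℂ)ˣ) : Matrix n n ℂ)) atTop (𝓝 ((ulim y : (Matrix n n ℂ)ˣ) : Matrix n n ℂ)))
  {C ϑ δ₀ : ℝ} (hϑ0 : 0 ≤ ϑ) (hϑ1 : ϑ < 1)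
  (hrate : ∀ j y, ‖(((u j) y : (Matrix n n ℂ)ˣ) : Matrix n n ℂ) - (ulim y : (Matrix n n ℂ)ˣ)‖ ≤ C * ϑ ^ j)
  (hDf : ∀ j, sliceDefectNL hL k hWu hx hs hWx N hθ U' (u j) ≤ ϑ ^ j * δ₀)

include hWP hU'u hU'P hε hA hKP hLP hskewNL hsplitNL hperNL hu huP hgu hXu hXbj hcu hhu hXsj hhsj hl hlP hconv hϑ0 hϑ1 hrate hDf in
/-- **THE (R1′) LIMIT IN ONE CALL, NL FACTS ON THE REGIME-SIZED WORKING REGION** ([NE7P1-G103-ASK-5b]): as `limitNLR_of_geometric`, but the three lemma-shaped NL state facts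
`hskewNL` ∕ `hsplitNL` ∕ `hperNL` are asked only of states `w` with the six 1∕8-facts AND `sup‖X(w)‖ ≤ b₀` (the seventh antecedent, dischargeable by partial application of
`NE7SliceIterationStateFactsNL.coarseDatumNL_skew_periodic` ∕ `splitNL_exists` ∕ `frameNL_periodic` with `b := b₀`); they are used at the orbit states (`hXbj`) and at the limit (bound
derived by `tendsto_repLog`).  Conclusion: (chart at `u⋆` ∧ `sup‖X(u⋆)‖ ≤ b₀` ∧ corners at `u⋆`) ∧ (SIZE INHERITANCE `‖X(u⋆)‖ ≤ sX` ∧ `‖h(u⋆)‖ ≤ sh` from the displayed per-`j`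
bounds `hXsj` ∕ `hhsj`) ∧ `T̃(u⋆) ∈ 𝒯_E(W)` ∧ `framePotW T̃(u⋆) = h̃(u⋆)` ∧ `mlog v_{k+1}(X(u⋆)) = h(u⋆) + framePotW Ñ(u⋆)` ∧ `m̃(u⋆) = 0` ∧ trivial split at `u⋆` ∧ `D̃f(u⋆) = 0`.
[folklore] -/
theorem limitNLR_of_geometric_reg :
    (gaugeAct ulim U' = vary W (repLog W U' ulim) 1 ∧ (∀ y κ, ‖repLog W U' ulim y κ‖ ≤ b₀) ∧
        (∀ z, ((ulim (((L : ℤ) ^ (k + 1)) • z) : (Matrix n n ℂ)ˣ) : Matrix n n ℂ) = exp (cornerLog L k ulim z))) ∧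
      ((∀ y κ, ‖repLog W U' ulim y κ‖ ≤ sX) ∧ (∀ z, ‖cornerLog L k ulim z‖ ≤ sh)) ∧
      tangentPartNL hL k hWu hx hs hWx N hθ U' ulim ∈ energyBlockLandauW (d := d) (n := n) L N (k + 1) W ∧
      framePotW L (k + 1) W (tangentPartNL hL k hWu hx hs hWx N hθ U' ulim) = effCornerLog L k W U' ulim ∧
      (∀ z, mlog ((vcov L W (relPert W (repLog W U' ulim)) (k + 1) z : (Matrix n n ℂ)ˣ) : Matrix n n ℂ)
        = cornerLog L k ulim z + framePotW L (k + 1) W (normalPartNL hL k hWu hx hs hWx N hθ U' ulim) z) ∧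
      frameMismatchNL hL k hWu hx hs hWx N hθ U' ulim = 0 ∧
      ((∀ y μ, slicePartNL hL k hWu hx hs hWx N hθ U' ulim y μ = tangentPartNL hL k hWu hx hs hWx N hθ U' ulim y μ) ∧
        ∀ y μ, gaugeDir W (gaugeFunNL hL k hWu hx hs hWx N hθ U' ulim) y μ = 0) ∧
      sliceDefectNL hL k hWu hx hs hWx N hθ U' ulim = 0 := by
  obtain ⟨hgl, hXl, hcl, hhl⟩ := workingRegion_of_limit k hWu hU'u hu hl hconv hgu hXu hcu hhu
  have hXbl : ∀ y κ, ‖repLog W U' ulim y κ‖ ≤ b₀ := fun y κ =>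
    le_of_tendsto' (tendsto_repLog hWu hU'u hu hl hconv hgu hXu y κ).norm fun j => hXbj j y κ
  have hXsl : ∀ y κ, ‖repLog W U' ulim y κ‖ ≤ sX := fun y κ =>
    le_of_tendsto' (tendsto_repLog hWu hU'u hu hl hconv hgu hXu y κ).norm fun j => hXsj j y κ
  have hhsl : ∀ z, ‖cornerLog L k ulim z‖ ≤ sh := fun z =>
    le_of_tendsto' (tendsto_cornerLog k hconv hcu hhu z).norm fun j => hhsj j z
  have hpow : Tendsto (fun j => ϑ ^ j) atTop (𝓝 0) := tendsto_pow_atTop_nhds_zero_of_lt_one hϑ0 hϑ1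
  have hr : Tendsto (fun j => C * ϑ ^ j) atTop (𝓝 0) := by simpa using hpow.const_mul C
  have hDf0 : Tendsto (fun j => sliceDefectNL hL k hWu hx hs hWx N hθ U' (u j)) atTop (𝓝 0) := by
    have hup : Tendsto (fun j => ϑ ^ j * δ₀) atTop (𝓝 0) := by simpa using hpow.mul_const δ₀
    exact squeeze_zero (fun j => sliceDefectNL_nonneg hL k hWu hx hs hWx N hθ U' (u j)) hDf hup
  have hφj : ∀ j, IsSkewDir (coarseDatumNL L k W U' (u j)) := fun j => hskewNL (u j) (hu j) (huP j) (hgu j) (hXu j) (hcu j) (hhu j) (hXbj j)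
  have hφl : IsSkewDir (coarseDatumNL L k W U' ulim) := hskewNL ulim hl hlP hgl hXl hcl hhl hXbl
  have hexj := fun j => hsplitNL (u j) (hu j) (huP j) (hgu j) (hXu j) (hcu j) (hhu j) (hXbj j)
  have hexl := hsplitNL ulim hl hlP hgl hXl hcl hhl hXbl
  have hperj := fun j => hperNL (u j) (hu j) (huP j) (hgu j) (hXu j) (hcu j) (hhu j) (hXbj j)
  exact ⟨⟨hgl, hXbl, hcl⟩, ⟨hXsl, hhsl⟩, limitNLR_of_rate hL k hWu hx hs hWx N hθ U' hWP hU'u hU'P hε hA hKP hLP u ulim hu huP hgu hXu hXbj hcu hhu hl hlP hgl hXl hXbl hcl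
    hhl hφj hφl hexj hperj (fun j => C * ϑ ^ j) hrate hr hDf0 hexl⟩

end GeometricReg

end

end Summit.QuantumFields.BalabanUV.T4Continuum.NE7SliceLimitNLR
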